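import Literature.Barriers.QuantumAdvantage.PPolyOraclesProofs
import Literature.Computability.Cryptography.ZhandryPRFMod
import Literature.Computability.QuantumComplexity.OracleSeparationBQPBPP
import Literature.Computability.QuantumComplexity.OracleSeparationBQPPHProofs
import HarnessLib

/-!
# Aaronson–Chen 2017, Thm. 7.6 from a secure PRP: the diagonalization, proved; Lemma 7.5 and the model bridges as leaves

Sibling of `Literature/Barriers/QuantumAdvantage/PPolyOraclesProofs.lean`, whose leaf
`aaronsonChen2017_thm76_of_prp : PRPExist → PPolyOracleSeparation` ("§7.2–7.3: a classically
secure PRP yields an oracle `O ∈ P/poly` with `BPP^O ≠ BQP^O`") this file DECOMPOSES one level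
further: the argument of the printed proof of Thm. 7.6 (S. Aaronson, L. Chen, CCC 2017,
arXiv:1612.05903 [AaronsonChen2017], p. 30) is PROVED here, in the deterministic stage form of
oracle theory already used by the tree for Raz–Tal's separation
(`QuantumComplexity/OracleSeparationBQPPH.lean`, `…BQPBPP.lean`), from five leaves stated in the
tree's models: the two halves of Lemma 7.5 (1) (`Cryptography/ZhandryPRFMod.lean`), the quantum
half of Lemma 7.5 together with the `BQP^O` machine of the proof (`aaronsonChen2017_lem75_quantum`),
the use of a `BPP^O` machine as a PRF adversary (`acLang_bppCompiles`) and the last sentence of the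
proof, "each `f_n` has a polynomial-size circuit, and consequently `O ∈ P/poly`"
(`aaronsonChen2017_thm76_ppoly`).

**The printed proof** (p. 30, with App. 13, p. 42, for Lemma 7.5). "The oracle `O` will encode the
truth tables of functions `f_1, f_2, …`, where each `f_n` is a function from `X^raw_n` to `X^raw_n`.
For each `n`, with probability `0.5` we draw `f_n` from `PRP^raw_{K^raw}` … and with probability
`0.5` we draw `f_n` from `PRF^mod_{K^mod}` similarly. We set `L` to be the unary language consisting
of all `0ⁿ` for which `f_n` is drawn from `PRP^raw`. By Lemma 7.5, there exists a `BQP` machine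
`M^O` that decides `L` correctly on all but finite many values of `n` with probability `1`. Since
we can simply hardwire the values of `n` on which `M^O` is incorrect, it follows that `L ∈ BQP^O`
with probability `1`. On the other hand, again by Lemma 7.5, no `BPP` machine can distinguish
`PRP^raw_{K^raw}` and `PRF^mod_{K^mod}` with a non-negligible advantage. So let `M` be a `BPP`
machine, and let `E_n(M)` be the event that `M` decides whether `0ⁿ ∈ L` correctly. We have
`Pr_O[E_n(M)] = 1/2 + o(1)`, even conditioning on events `E_1(M), …, E_{n−1}(M)` … Since there are
countably many `BPP` machines, it follows that `L ∉ BPP^O` with probability `1`. … Finally, note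
that each `f_n` has a polynomial-size circuit, and consequently `O ∈ P/poly`." Lemma 7.5 (3),
proof (p. 42): "our distinguisher `A` tries to recover a period `a` using [Boneh–Lipton period
finding], and accepts only if `f(1) = f(1 + a)`. When `f ← PRP^raw`, note that `f` is a
permutation, which means `A` accepts with probability `0` in this case. On the other side, when
`f ← PRF^mod`, … `A` accepts with probability at least `1 − ε`."

**The form proved here** (deterministic stages instead of a random oracle; compare the module
docstring of `OracleSeparationBQPPH.lean`). Fix the secure PRP `F` (key length `κ`, block length
`ℓ n ≥ n`) given by `PRPExist`.

* *Oracle encoding* (`acLang`): level `m` of the oracle holds a table `W m : {0,1}^{ℓ m} → {0,1}^{ℓ m}`;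
  the unary header `1^m 0 1^j 0 x` (`hdr m j x`, the tree's `UnaryArithMachines` format) belongs
  to the oracle iff bit `j` of the level-`m`
  value of `x` is set, where the value of `x` is `W m x` if `|x| = ℓ m` and `x` itself otherwise
  (`levelValue`; so a level holding the identity table is "the identity at every length", which a
  uniform machine can answer without knowing `ℓ m` — `ℓ` need not be computable).
* *Levels* are the identity permutation (default), a table `PRP^raw_k = F m k` (`rawTbl`) or a
  table `PRF^mod_{(k,a)}` (`modTbl`), cf. `IsACTable`; the separating language is
  `L = {x : |x| < n₀ ∨ W |x| is a permutation}` (the printed "all `0ⁿ` for which `f_n` is drawn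
  from `PRP^raw`", at every length, below the hard-wiring threshold `n₀` of the `BQP^O` machine):
  identity and `PRP^raw` levels are permutations, `PRF^mod` levels are not (`modTbl_not_injective`).
* *Stages* (`dSeq`): the `i`-th `BPP^O` description `(M, q, p)` (a `P^O` machine with its bound and
  a coin polynomial, `bp (PRel O)`) is treated at a fresh level `n_i`, where some `PRP^raw` table
  with acceptance probability of `M` at `1^{n_i}` below `2/3`, or some `PRF^mod` table with
  acceptance probability of `M` above `1/3`, exists (`exists_defeating_table`): otherwise `M`,
  compiled into a PPT oracle adversary for the PRF game against the current finitely supported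
  background (`acLang_bppCompiles`), would tell `PRP^raw` from `PRF^mod` with advantage
  `≥ 2/3 − 1/3 > 1/10`, contradicting Lemma 7.5 (1) (`acTables_gap_small`, from
  `aaronsonChen2017_lem75_eventually_le`); everything `M` read is then frozen (`PHDescr.reach`).
* *Assembly* (`aaronsonChen2017_thm76_of_prp_of_parts`): `L ∈ BQP^O` (the uniform family of the
  quantum leaf accepts below `n₀`, accepts every permutation level and rejects every `PRF^mod`
  level, whatever the other levels hold), `L ∉ BPP^O` (stage `i` defeats the `i`-th description,
  locality `accAt_congr`), and `O ∈ P/poly` (leaf).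

**What remains** for `aaronsonChen2017_thm76_of_prp` (hence, with HILL, GGM and Luby–Rackoff, for
`aaronsonChen2017_thm76_holds`): the five leaves `aaronsonChen2017_lem75_prp_isPRF`,
`aaronsonChen2017_lem75_prfMod_isPRF` (`ZhandryPRFMod.lean`), `aaronsonChen2017_lem75_quantum`,
`acLang_bppCompiles`, `aaronsonChen2017_thm76_ppoly` (this file) — see `aaronsonChen2017_thm76_of_leaves'`.

## Design notes

* Headers `hdr m j x = 1^m 0 1^j 0 x` have length `> m`, so a machine with reach `R` at its
  probe only reads levels `m ≤ R` (`acLang_congr`); no monotonicity of `ℓ` is needed.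
* The quantum leaf is stated as bounded-error DECISION, by inequalities only (review of the split,
  D-0026; the first version carried an abstract acceptance function `accQ n : Tbl ℓ n → ℝ` with an
  exact locality clause and an average rejection bound `modAvg (accQ n) ≤ ε n → 0`, which forced a
  monolithic exact analysis of the machine and a growing number of repetitions without serving the
  assembly): the uniform family accepts inputs shorter than a threshold `n₀` (the printed
  hardwiring), and from `n₀` on, relative to `acLang W` for ANY assignment `W`, it accepts `x` with
  probability `≥ 2/3` when `W |x|` is a permutation ("when `f ← PRP^raw`, `f` is a permutation,
  which means `A` accepts [a period] with probability `0`") and with probability `≤ 1/3` when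
  `W |x|` is a `PRF^mod` table, for every well-formed key and modulus (App. 13: Boneh–Lipton period
  finding recovers `a` for every `f = g_{mod a}` with `g` a permutation; error `1/3` per key in
  place of the printed negligible error on average over `K^mod`). Locality in the level is carried
  by the quantification over all `W`; the discharge may therefore use the tree's generic
  composition theorems for uniform oracle families, which give kernel inequalities
  (`exists_uniform_classicalWrap_rel`, `kernelProb_headD_true`, finite patching through
  `isUniform_iff_descFn_mem_FP` and `mem_FP_of_eqOn_le`).
* `countable_polyTimeOracleAlg` is fed by its discharge `countable_polyTimeOracleAlg_holds`
  (`OracleSeparationBQPPHProofs.lean`).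

## Sources

* [AaronsonChen2017] arXiv:1612.05903 (held; `lit read arxiv:1612.05903`): §7.2, Lemma 7.5
  (pp. 29–30), Thm. 7.6 and its proof (p. 30), App. 13 (proof of Lemma 7.5, p. 42).
* [Ko1989] K.-I Ko, *Constructing oracles by lower bound techniques for circuits* (1989), §3 (stage
  constructions), through the tree's `OracleSeparationBQPPH.lean`.
* [BakerGillSolovay1975] T. Baker, J. Gill, R. Solovay, SIAM J. Comput. 4 (1975), §1 (locality of
  oracle machines), through `run_congr`/`uniformProb_baseLang_congr`.
* [AroraBarak2009] S. Arora, B. Barak, *Computational Complexity* (2009), Def. 7.3 with §3.4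
  (`BPP^O` via coin strings), Def. 6.5 (`P/poly`).
-/

noncomputable section

namespace Literature.Barriers.QuantumAdvantage

open Filter Topology
open _root_.Computability Literature.Computability.Complexity Literature.Computability.Cryptography
open Literature.Computability.QuantumComplexity (PHDescr baseLang uniformProb_baseLang_congr
  baseLang_eq_of_PRel exists_enum_PHDescr countable_polyTimeOracleAlg countable_polyTimeOracleAlg_holds)

/-! ### Level tables and the oracle language -/

/-- The table type of level `n`: functions `{0,1}^{ℓ n} → {0,1}^{ℓ n}` ("each `f_n` is a function
from `X^raw_n` to `X^raw_n`"). [cite: AaronsonChen2017, Thm. 7.6 (proof, p. 30)] -/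
abbrev Tbl (ℓ : ℕ → ℕ) (n : ℕ) : Type :=
  List.Vector Bool (ℓ n) → List.Vector Bool (ℓ n)

/-- An assignment of a table to every level (the data of the oracle "encoding the truth tables of
functions `f_1, f_2, …`"). [cite: AaronsonChen2017, Thm. 7.6 (proof, p. 30)] -/
abbrev Tables (ℓ : ℕ → ℕ) : Type :=
  ∀ n, Tbl ℓ n

variable {ℓ : ℕ → ℕ}

/-- The level-`m` value of a string `x`: the table value if `x` has the table's input length
`ℓ m`, and `x` itself otherwise (so the identity table is the identity at every length). [folklore] -/
def levelValue (W : Tables ℓ) (m : ℕ) (x : List Bool) : List Bool :=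
  if h : x.length = ℓ m then (W m ⟨x, h⟩).toList else x

/-- **The oracle language of an assignment of tables**: the unary header `hdr m j x = 1^m 0 1^j 0 x`
(`UnaryArithMachines.lean`) belongs to `acLang W` iff bit `j` of the level-`m` value of `x` is `1`
(the oracle "encoding the truth tables of `f_1, f_2, …`").
[cite: AaronsonChen2017, Thm. 7.6 (proof, p. 30)] -/
def acLang (W : Tables ℓ) : Language Bool :=
  {s | ∃ (m j : ℕ) (x : List Bool), hdr m j x = s ∧ (levelValue W m x).getD j false = true}

/-- Headers are uniquely decodable (two applications of the tree's parser `splitOnes`). [folklore] -/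
theorem hdr_injective {m j m' j' : ℕ} {x x' : List Bool} (h : hdr m j x = hdr m' j' x') :
    m = m' ∧ j = j' ∧ x = x' := by
  have h1 := congrArg splitOnes h
  rw [hdr, hdr, splitOnes_ones_append, splitOnes_ones_append, Prod.mk.injEq] at h1
  obtain ⟨rfl, h2⟩ := h1
  have h3 := congrArg splitOnes h2
  rw [splitOnes_ones_append, splitOnes_ones_append, Prod.mk.injEq] at h3
  exact ⟨rfl, h3.1, h3.2⟩

/-- A header of level `m` is longer than `m`. [folklore] -/
theorem lt_length_hdr (m j : ℕ) (x : List Bool) : m < (hdr m j x).length := by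
  rw [length_hdr]; omega

/-- Membership of a header in the oracle language. [cite: AaronsonChen2017, Thm. 7.6 (proof, p. 30)] -/
theorem hdr_mem_acLang (W : Tables ℓ) (m j : ℕ) (x : List Bool) :
    hdr m j x ∈ acLang W ↔ (levelValue W m x).getD j false = true := by
  constructor
  · rintro ⟨m', j', x', h, hv⟩
    obtain ⟨rfl, rfl, rfl⟩ := hdr_injective h
    exact hv
  · exact fun hv => ⟨m, j, x, rfl, hv⟩

/-- **Locality of the encoding**: membership of a string of length at most `B` only depends on
the tables of the levels `m ≤ B` (a header of level `m` is longer than `m`). [folklore] -/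
theorem acLang_congr {W W' : Tables ℓ} {B : ℕ} (h : ∀ m, m ≤ B → W m = W' m) (s : List Bool)
    (hs : s.length ≤ B) : s ∈ acLang W ↔ s ∈ acLang W' := by
  have key : ∀ (m j : ℕ) (x : List Bool), hdr m j x = s → levelValue W m x = levelValue W' m x := by
    intro m j x hm
    have hmB : m ≤ B := by
      have := lt_length_hdr m j x
      rw [hm] at this
      omega
    simp only [levelValue, h m hmB]
  constructor
  · rintro ⟨m, j, x, hm, hv⟩
    exact ⟨m, j, x, hm, by rwa [← key m j x hm]⟩
  · rintro ⟨m, j, x, hm, hv⟩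
    exact ⟨m, j, x, hm, by rwa [key m j x hm]⟩

/-- The level value after reassigning level `n`. [folklore] -/
theorem levelValue_update (W : Tables ℓ) (n : ℕ) (g : Tbl ℓ n) (m : ℕ) (x : List Bool) :
    levelValue (Function.update W n g) m x =
      if m = n then levelValue (Function.update W n g) n x else levelValue W m x := by
  by_cases hm : m = n
  · subst hm; simp
  · simp [levelValue, hm]

/-! ### The tables of the construction: `PRP^raw_k`, `PRF^mod_{(k,a)}`, identity -/

/-- The table of a string function `f` at level `n` (junk — the input — where `f` has the wrong
output length, which never happens for the well-keyed functions below). [folklore] -/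
def toTbl (ℓ : ℕ → ℕ) (n : ℕ) (f : List Bool → List Bool) : Tbl ℓ n :=
  fun x => if h : (f x.toList).length = ℓ n then ⟨f x.toList, h⟩ else x

/-- The level-`n` table of `PRP^raw_k = F n k`. [cite: AaronsonChen2017, Thm. 7.6 (proof, p. 30)] -/
def rawTbl (F : FunctionEnsemble) (ℓ : ℕ → ℕ) (n : ℕ) (k : List Bool) : Tbl ℓ n :=
  toTbl ℓ n (F n k)

/-- The level-`n` table of `PRF^mod_{(k,a)}` (`prfMod`, `ZhandryPRFMod.lean`). [cite: AaronsonChen2017, §7.2 and Thm. 7.6 (proof)] -/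
def modTbl (F : FunctionEnsemble) (ℓ : ℕ → ℕ) (n : ℕ) (k : List Bool) (a : ℕ) : Tbl ℓ n :=
  toTbl ℓ n (prfMod F ℓ n k a)

/-- The tables occurring in the construction at level `n`: the identity (levels not used by any
stage), a `PRP^raw` table with a well-formed key, or a `PRF^mod` table with a well-formed key and
a modulus from `A`. [cite: AaronsonChen2017, Thm. 7.6 (proof, p. 30)] -/
def IsACTable (F : FunctionEnsemble) (κ ℓ : ℕ → ℕ) (n : ℕ) (g : Tbl ℓ n) : Prop :=
  g = id ∨ (∃ k : List Bool, k.length = κ n ∧ g = rawTbl F ℓ n k) ∨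
    ∃ (k : List Bool) (a : ℕ), k.length = κ n ∧ a ∈ zhandryModuli (2 ^ ℓ n) ∧ g = modTbl F ℓ n k a

/-- The oracle of the table of a length-correct function is the PRF-game oracle of the function
(`oracleOfTable` versus `oracleOfFnAt`). [folklore] -/
theorem oracleOfTable_toTbl {n : ℕ} {f : List Bool → List Bool}
    (hf : ∀ x : List Bool, x.length = ℓ n → (f x).length = ℓ n) :
    oracleOfTable (toTbl ℓ n f) = oracleOfFnAt (ℓ n) f := by
  funext q
  by_cases hq : q.length = ℓ n
  · rw [oracleOfTable_apply_of_length_eq _ hq, oracleOfFnAt_apply_of_length_eq _ hq]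
    simp [toTbl, hf q hq]
  · rw [oracleOfTable_apply_of_length_ne _ hq, oracleOfFnAt_apply_of_length_ne _ hq]

/-- For a well-formed key the `PRP^raw` table presents the oracle `F n k` of the real PRF game.
[cite: AaronsonChen2017, Def. 7.1–7.2] -/
theorem oracleOfTable_rawTbl {F : FunctionEnsemble} {κ ℓ : ℕ → ℕ} (hF : IsEfficientFamily F κ ℓ ℓ)
    (n : ℕ) {k : List Bool} (hk : k.length = κ n) :
    oracleOfTable (rawTbl F ℓ n k) = oracleOfFnAt (ℓ n) (F n k) :=
  oracleOfTable_toTbl fun x hx => hF.2.2 n k x hk hx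

/-- For a well-formed key the `PRF^mod` table presents the oracle `PRF^mod_{(k,a)}`.
[cite: AaronsonChen2017, §7.2] -/
theorem oracleOfTable_modTbl {F : FunctionEnsemble} {κ ℓ : ℕ → ℕ} (hF : IsEfficientFamily F κ ℓ ℓ)
    (n : ℕ) {k : List Bool} (hk : k.length = κ n) (a : ℕ) :
    oracleOfTable (modTbl F ℓ n k a) = oracleOfFnAt (ℓ n) (prfMod F ℓ n k a) :=
  oracleOfTable_toTbl fun x _ => length_prfMod hF n hk a x

/-- **A `PRP^raw` table is a permutation** ("`PRP_k` is a permutation on `X` for each `k ∈ K`").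
[cite: AaronsonChen2017, Def. 7.1] -/
theorem rawTbl_bijective {F : FunctionEnsemble} {κ ℓ : ℕ → ℕ} (hF : IsPRP F κ ℓ) (n : ℕ)
    {k : List Bool} (hk : k.length = κ n) : Function.Bijective (rawTbl F ℓ n k) := by
  have hbij := hF.isPermutationFamily n k hk
  have hval : ∀ x : List.Vector Bool (ℓ n), (rawTbl F ℓ n k x).toList = F n k x.toList := by
    intro x
    have hlen : (F n k x.toList).length = ℓ n := hbij.mapsTo (x := x.toList) x.toList_length
    simp [rawTbl, toTbl, hlen]
  constructor
  · intro x y hxy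
    have h := congrArg List.Vector.toList hxy
    rw [hval, hval] at h
    exact Subtype.ext (hbij.injOn x.toList_length y.toList_length h)
  · intro y
    obtain ⟨x, hx, hxy⟩ := hbij.surjOn y.toList_length
    refine ⟨⟨x, hx⟩, Subtype.ext ?_⟩
    change (rawTbl F ℓ n k ⟨x, hx⟩).toList = y.toList
    rw [hval]
    exact hxy

/-- The identity table is a permutation. [folklore] -/
theorem id_bijective_tbl (n : ℕ) : Function.Bijective (id : Tbl ℓ n) :=
  Function.bijective_id

/-- **A `PRF^mod` table is not a permutation** ("we denote the latter one by `PRF^mod` (not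
`PRP^mod`) because it is no longer a PRP", §7.2): for a well-formed key and a modulus `a ∈ A`
(so `2 ≤ a < 2^{ℓ n}`) the inputs of value `0` and `a` are distinct and collide.
[cite: AaronsonChen2017, §7.2 (p. 29)] -/
theorem modTbl_not_injective {F : FunctionEnsemble} {κ ℓ : ℕ → ℕ} (hF : IsEfficientFamily F κ ℓ ℓ)
    (n : ℕ) {k : List Bool} (hk : k.length = κ n) {a : ℕ} (ha : a ∈ zhandryModuli (2 ^ ℓ n)) :
    ¬ Function.Injective (modTbl F ℓ n k a) := by
  intro hinj
  have ha2 : 2 ≤ a := (prime_of_mem_zhandryModuli ha).two_le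
  have hpos : 0 < 2 ^ ℓ n := Nat.two_pow_pos _
  have haN : a < 2 ^ ℓ n := by
    have h1 := (mem_zhandryModuli.1 ha).2.1
    have h2 : Nat.sqrt (2 ^ ℓ n) ≤ 2 ^ ℓ n := Nat.sqrt_le_self _
    omega
  -- the values of the table are the values of `prfMod` (well-formed key: correct length)
  have hval : ∀ x : List.Vector Bool (ℓ n), (modTbl F ℓ n k a x).toList = prfMod F ℓ n k a x.toList := by
    intro x
    have hlen : (prfMod F ℓ n k a x.toList).length = ℓ n := length_prfMod hF n hk a x.toList
    simp [modTbl, toTbl, hlen]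
  -- the two colliding inputs `0` and `a`
  have h0 : Literature.Computability.Complexity.bitsToNat
      (Literature.Computability.Complexity.natBits (ℓ n) 0) = 0 :=
    Literature.Computability.Complexity.bitsToNat_natBits hpos
  have h1 : Literature.Computability.Complexity.bitsToNat
      (Literature.Computability.Complexity.natBits (ℓ n) a) = a :=
    Literature.Computability.Complexity.bitsToNat_natBits haN
  have hne : (⟨Literature.Computability.Complexity.natBits (ℓ n) 0,
      Literature.Computability.Complexity.length_natBits _ _⟩ : List.Vector Bool (ℓ n)) ≠
      ⟨Literature.Computability.Complexity.natBits (ℓ n) a,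
        Literature.Computability.Complexity.length_natBits _ _⟩ := by
    intro h
    have h' := congrArg (fun v : List.Vector Bool (ℓ n) =>
      Literature.Computability.Complexity.bitsToNat v.toList) h
    simp only [List.Vector.toList_mk] at h'
    rw [h0, h1] at h'
    omega
  refine hne (hinj (Subtype.ext ?_))
  show (modTbl F ℓ n k a _).toList = (modTbl F ℓ n k a _).toList
  rw [hval, hval]
  refine prfMod_eq_of_mod_eq F ℓ n k a ?_
  simp only [List.Vector.toList_mk]
  rw [h0, h1, Nat.zero_mod, Nat.mod_self]

/-! ### Averages over the keys -/

/-- The average of `φ` over the `PRP^raw` tables, `k` uniform in `{0,1}^{κ n}`. [cite: AaronsonChen2017, Def. 7.2] -/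
def rawAvg (F : FunctionEnsemble) (κ ℓ : ℕ → ℕ) (n : ℕ) (φ : Tbl ℓ n → ℝ) : ℝ :=
  (∑ k : List.Vector Bool (κ n), φ (rawTbl F ℓ n k.toList)) / 2 ^ κ n

/-- The average of `φ` over the `PRF^mod` tables, `(k, a)` uniform in `{0,1}^{κ n} × A`
(value `0` if `A = ∅`). [cite: AaronsonChen2017, §7.2 and Def. 7.2] -/
def modAvg (F : FunctionEnsemble) (κ ℓ : ℕ → ℕ) (n : ℕ) (φ : Tbl ℓ n → ℝ) : ℝ :=
  (∑ k : List.Vector Bool (κ n), ∑ a ∈ zhandryModuli (2 ^ ℓ n), φ (modTbl F ℓ n k.toList a)) /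
    (2 ^ κ n * ((zhandryModuli (2 ^ ℓ n)).card : ℝ))

/-- A lower bound transfers to the raw average. [folklore] -/
theorem le_rawAvg {F : FunctionEnsemble} {κ ℓ : ℕ → ℕ} {n : ℕ} {φ : Tbl ℓ n → ℝ} {c : ℝ}
    (h : ∀ k : List.Vector Bool (κ n), c ≤ φ (rawTbl F ℓ n k.toList)) : c ≤ rawAvg F κ ℓ n φ := by
  unfold rawAvg
  rw [le_div_iff₀ (by positivity)]
  calc c * 2 ^ κ n = ∑ _k : List.Vector Bool (κ n), c := by
        simp [Finset.sum_const, Finset.card_univ, card_vector, mul_comm]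
    _ ≤ _ := Finset.sum_le_sum fun k _ => h k

/-- An affine upper bound transfers to the mod average (moduli set nonempty). [folklore] -/
theorem modAvg_le_affine {F : FunctionEnsemble} {κ ℓ : ℕ → ℕ} {n : ℕ} {φ ψ : Tbl ℓ n → ℝ}
    {c d : ℝ} (hne : (zhandryModuli (2 ^ ℓ n)).Nonempty)
    (h : ∀ (k : List.Vector Bool (κ n)) (a : ℕ), a ∈ zhandryModuli (2 ^ ℓ n) →
      φ (modTbl F ℓ n k.toList a) ≤ c + d * ψ (modTbl F ℓ n k.toList a)) :
    modAvg F κ ℓ n φ ≤ c + d * modAvg F κ ℓ n ψ := by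
  unfold modAvg
  have hpos : (0 : ℝ) < 2 ^ κ n * ((zhandryModuli (2 ^ ℓ n)).card : ℝ) := by
    have := hne.card_pos
    positivity
  rw [div_le_iff₀ hpos, add_mul, mul_assoc, div_mul_cancel₀ _ hpos.ne']
  calc ∑ k : List.Vector Bool (κ n), ∑ a ∈ zhandryModuli (2 ^ ℓ n), φ (modTbl F ℓ n k.toList a)
      ≤ ∑ k : List.Vector Bool (κ n), ∑ a ∈ zhandryModuli (2 ^ ℓ n),
          (c + d * ψ (modTbl F ℓ n k.toList a)) :=
        Finset.sum_le_sum fun k _ => Finset.sum_le_sum fun a ha => h k a ha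
    _ = c * (2 ^ κ n * ((zhandryModuli (2 ^ ℓ n)).card : ℝ)) +
          d * ∑ k : List.Vector Bool (κ n), ∑ a ∈ zhandryModuli (2 ^ ℓ n),
            ψ (modTbl F ℓ n k.toList a) := by
        simp only [Finset.sum_add_distrib, Finset.sum_const, Finset.card_univ, card_vector,
          Fintype.card_bool, nsmul_eq_mul, Finset.mul_sum]
        push_cast
        ring

/-- A pointwise upper bound by a nonnegative constant transfers to the mod average (also when the
moduli set is empty, where the average is `0`). [folklore] -/
theorem modAvg_le_of_forall_le {F : FunctionEnsemble} {κ ℓ : ℕ → ℕ} {n : ℕ} {φ : Tbl ℓ n → ℝ}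
    {c : ℝ} (hc : 0 ≤ c)
    (h : ∀ (k : List.Vector Bool (κ n)) (a : ℕ), a ∈ zhandryModuli (2 ^ ℓ n) →
      φ (modTbl F ℓ n k.toList a) ≤ c) :
    modAvg F κ ℓ n φ ≤ c := by
  rcases (zhandryModuli (2 ^ ℓ n)).eq_empty_or_nonempty with h0 | hne
  · unfold modAvg
    simp [h0, hc]
  · have key := modAvg_le_affine (F := F) (κ := κ) (φ := φ) (ψ := φ) (c := c) (d := 0) hne
      (fun k a ha => by simpa using h k a ha)
    simpa using key

/-! ### The acceptance probability of a `BPP^O` description at the probe `1ⁿ` -/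

/-- The acceptance probability at the probe `1ⁿ` of the `BPP^O` description `(M, q, p)` — a `P^O`
machine `M` with round/query bound `q` run on `⟨1ⁿ, r⟩` for a uniformly random coin string
`r ∈ {0,1}^{p(n)}` — relative to the oracle language `A` (`bp (PRel O)`, Arora–Barak Def. 7.3).
[cite: AroraBarak2009, Def. 7.3 with §3.4] -/
def accAt (M : OracleAlg Bool) (q p : Polynomial ℕ) (A : Language Bool) (n : ℕ) : ℝ :=
  uniformProb (p.eval n) {r | boolPair (List.replicate n true) r ∈ baseLang M q A}

/-- `accAt` is a probability: nonnegative. [cite: AroraBarak2009, §7.1] -/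
theorem accAt_nonneg (M : OracleAlg Bool) (q p : Polynomial ℕ) (A : Language Bool) (n : ℕ) :
    0 ≤ accAt M q p A n :=
  uniformProb_nonneg _ _

/-- `accAt` is a probability: at most `1`. [cite: AroraBarak2009, §7.1] -/
theorem accAt_le_one (M : OracleAlg Bool) (q p : Polynomial ℕ) (A : Language Bool) (n : ℕ) :
    accAt M q p A n ≤ 1 :=
  uniformProb_le_one _ _

/-- **Locality** (Baker–Gill–Solovay): the acceptance probability at `1ⁿ` only depends on the
oracle below the reach of the description `⟨[p], M, q⟩` at `n`. [cite: BakerGillSolovay1975, §1] -/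
theorem accAt_congr (M : OracleAlg Bool) (q p : Polynomial ℕ) {A A' : Language Bool} (n : ℕ)
    (h : ∀ s : List Bool, s.length ≤ PHDescr.reach ⟨[p], M, q⟩ n → (s ∈ A ↔ s ∈ A')) :
    accAt M q p A n = accAt M q p A' n := by
  have h' := uniformProb_baseLang_congr M q p (A := A) (A' := A') (List.replicate n true)
    (fun s hs => h s (by rwa [List.length_replicate] at hs))
  rwa [List.length_replicate] at h'

/-! ### The leaves -/

/-- **Leaf (quantum side): Lemma 7.5 (2)–(3) and the `BQP^O` machine of the proof of Thm. 7.6, in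
the tree's `BQPRel` model relative to the encoding `acLang`** ("By Lemma 7.5, there exists a `BQP`
machine `M^O` that decides `L` correctly on all but finite many values of `n` … Since we can
simply hardwire the values of `n` on which `M^O` is incorrect, it follows that `L ∈ BQP^O`";
Lemma 7.5 (3), App. 13: the distinguisher "tries to recover a period `a` using [Boneh–Lipton
period finding] and accepts only if `f(1) = f(1 + a)`. When `f ← PRP^raw`, `f` is a permutation,
which means `A` accepts with probability `0`. … when `f ← PRF^mod`, `A` can recover the period `a`
with probability at least `1 − ε`"). For the secure PRP `F` (block length `ℓ n ≥ n`) there are a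
threshold `n₀` and ONE poly-time uniform family `U` of Clifford+T circuits with oracle gates such
that: (i) `U` accepts every input shorter than `n₀` (probability `≥ 2/3`, relative to any oracle:
the hard-wired lengths); (ii) on an input `x` with `|x| ≥ n₀`, relative to `acLang W` for ANY
assignment `W` of tables (the machine only queries the level-`|x|` headers `hdr |x| j x'`, at
every candidate block length `j` below the polynomial bound of `IsEfficientFamily`, the table
being read at `j = ℓ |x|` and the identity at the other lengths), `U` accepts `x` with probability
`≥ 2/3` whenever the table `W |x|` is a PERMUTATION (no verified period exists: the printed
"accepts [a period] with probability `0`", for every permutation, not only `PRP^raw` tables); and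
(iii) with probability `≤ 1/3` whenever `W |x|` is a `PRF^mod` table `modTbl F ℓ |x| k a` with a
well-formed key `k` and a modulus `a ∈ A` (period finding over `[0, 2^{ℓ|x|})`, `a² ≤ 2^{ℓ|x|}` by
`sq_le_of_mem_zhandryModuli`, recovers `a` for EVERY such table since `F |x| k` is a permutation,
and the collision `f(0) = f(a)` is then confirmed — the per-key content of the printed "with
probability at least `1 − ε`" over `(k, a) ← K^mod`, with the `BQP` error `1/3` in place of the
amplified negligible error). Named fact; its discharge is the construction of that family in the
tree's Q2 model (exact Clifford+T: Kitaev's Hadamard tests of the controlled modular shifts of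
the index register in place of the Fourier transform, `KitaevPhaseEstimationCircuit.lean`; the
coset weights are Shor's `outcomeProb`, `ShorOrderFindingAnalysis.lean`) with its uniformity.
Stated by inequalities and for all `W`, so that generic composition of uniform oracle families
(`exists_uniform_classicalWrap_rel`) and finite patching apply; see the module docstring.
[cite: AaronsonChen2017, Lemma 7.5 (2)–(3) (p. 30), App. 13 (p. 42) and Thm. 7.6 (proof, p. 30)] -/
def aaronsonChen2017_lem75_quantum : Prop :=
  ∀ (F : FunctionEnsemble) (κ ℓ : ℕ → ℕ), IsPRP F κ ℓ → (∀ n, n ≤ ℓ n) →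
    ∃ (n₀ : ℕ) (U : QCircuitFamily cliffordT), U.IsUniform ∧
      (∀ (A : Language Bool) (x : List Bool), x.length < n₀ → 2 / 3 ≤ U.acceptProbOn A x) ∧
      (∀ (W : Tables ℓ) (x : List Bool), n₀ ≤ x.length →
        Function.Bijective (W x.length) → 2 / 3 ≤ U.acceptProbOn (acLang W) x) ∧
      (∀ (W : Tables ℓ) (x : List Bool), n₀ ≤ x.length → ∀ (k : List Bool) (a : ℕ),
        k.length = κ x.length → a ∈ zhandryModuli (2 ^ ℓ x.length) →
          W x.length = modTbl F ℓ x.length k a → U.acceptProbOn (acLang W) x ≤ 1 / 3)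

/-- **Leaf (model bridge): a `BPP^O` description probing one level is a PPT adversary in the PRF
game** — the step "let `M` be a `BPP` machine … [it cannot] distinguish `PRP^raw_{K^raw}` and
`PRF^mod_{K^mod}`" of the proof of Thm. 7.6, in the tree's models. For every polynomial-time `P^O`
machine `M` with bound `q`, coin polynomial `p`, and every background assignment `W` that is the
identity outside a finite set `S` of levels, there is a probabilistic polynomial-time oracle
adversary `𝒜` (C4a `OracleAdversary`, input `1ⁿ`, oracle access to a table `g` of level `n` through
`oracleOfTable`) whose acceptance probability equals, for every `n` and `g`, the acceptance
probability of `(M, q, p)` at `1ⁿ` relative to `acLang (W[n ↦ g])`: `𝒜` draws the coins, runs `M`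
on `⟨1ⁿ, r⟩` and answers its oracle queries itself — headers of level `n` by one query `x` to its
own oracle (using the answer, or `x` when the answer is empty), headers of the finitely many
levels in `S` from hardwired tables, all other headers by the identity (the tree's `FP` parsers
`kOf`/`aOf`/`zOf` of `SplitOnesBricks.lean` read this format) — so `ℓ` need not be computable. Named fact (its discharge is a `TM2` simulation, cf.
`OracleAdversary.exists_ppt_outputPMF_precomp`). [cite: AaronsonChen2017, Thm. 7.6 (proof, p. 30)] [cite: AroraBarak2009, Def. 7.3 with §3.4] -/
def acLang_bppCompiles : Prop :=
  ∀ (ℓ : ℕ → ℕ) (M : OracleAlg Bool), M.IsPolyTime encodingBoolBool →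
    ∀ (q p : Polynomial ℕ) (W : Tables ℓ) (S : Finset ℕ), (∀ m, m ∉ S → W m = id) →
      ∃ 𝒜 : OracleAdversary Bool, 𝒜.IsPPT encodingBoolBool ∧
        ∀ (n : ℕ) (g : Tbl ℓ n),
          𝒜.acceptProb (oracleOfTable g) n = accAt M q p (acLang (Function.update W n g)) n

/-- **Leaf (`P/poly` side): "each `f_n` has a polynomial-size circuit, and consequently
`O ∈ P/poly`."** For the secure (in particular efficiently computable) PRP `F`, every assignment
whose levels are identity, `PRP^raw` or `PRF^mod` tables (with well-formed keys) encodes, through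
`acLang`, a language in the tree's `PPoly` (polynomial-size `B₂`-circuit families): at length `t`
the circuit decodes the header `1^m 0 1^j 0 x`, and evaluates bit `j` of `F m k x` (a polynomial-size circuit
for the polynomial-time `F` with the key hardwired), of `F m k (x mod a)`, or of `x`. Named fact.
[cite: AaronsonChen2017, Thm. 7.6 (proof, last sentence, p. 30)] [cite: AroraBarak2009, Def. 6.5] -/
def aaronsonChen2017_thm76_ppoly : Prop :=
  ∀ (F : FunctionEnsemble) (κ ℓ : ℕ → ℕ), IsPRP F κ ℓ → (∀ n, n ≤ ℓ n) →
    ∀ W : Tables ℓ, (∀ n, IsACTable F κ ℓ n (W n)) → acLang W ∈ PPoly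

/-! ### The classical gap at one level is small (Lemma 7.5 (1) applied to a compiled `BPP^O` machine) -/

/-- The raw-key average of the compiled adversary's acceptance is the real PRF game of `F`.
[cite: AaronsonChen2017, Def. 7.2] -/
theorem rawAvg_acceptProb {F : FunctionEnsemble} {κ ℓ : ℕ → ℕ} (hF : IsEfficientFamily F κ ℓ ℓ)
    (𝒜 : OracleAdversary Bool) (n : ℕ) :
    rawAvg F κ ℓ n (fun g => 𝒜.acceptProb (oracleOfTable g) n) = prfRealProb F κ ℓ 𝒜 n := by
  rw [prfRealProb_eq_sum, rawAvg]
  congr 1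
  refine Finset.sum_congr rfl fun k _ => ?_
  rw [oracleOfTable_rawTbl hF n k.toList_length]

/-- The mod-key average of the compiled adversary's acceptance is the real game of `PRF^mod`.
[cite: AaronsonChen2017, §7.2 and Def. 7.2] -/
theorem modAvg_acceptProb {F : FunctionEnsemble} {κ ℓ : ℕ → ℕ} (hF : IsEfficientFamily F κ ℓ ℓ)
    (𝒜 : OracleAdversary Bool) (n : ℕ) :
    modAvg F κ ℓ n (fun g => 𝒜.acceptProb (oracleOfTable g) n) = prfModRealProb F κ ℓ 𝒜 n := by
  rw [prfModRealProb, modAvg]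
  congr 1
  refine Finset.sum_congr rfl fun k _ => Finset.sum_congr rfl fun a _ => ?_
  rw [oracleOfTable_modTbl hF n k.toList_length]

/-- **The classical gap is small** ("no `BPP` machine can distinguish `PRP^raw_{K^raw}` and
`PRF^mod_{K^mod}` with a non-negligible advantage"): for a `BPP^O` description `(M, q, p)` and a
finitely supported background, from some level `n` on, the acceptance probabilities at `1ⁿ`
averaged over the `PRP^raw` tables and over the `PRF^mod` tables written into level `n` differ by
at most `δ` — by Lemma 7.5 (1) applied to the compiled adversary. [cite: AaronsonChen2017, Thm. 7.6 (proof, p. 30) and Lemma 7.5 (1)] -/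
theorem acTables_gap_small (h₁ : aaronsonChen2017_lem75_prp_isPRF)
    (h₂ : aaronsonChen2017_lem75_prfMod_isPRF) (hc : acLang_bppCompiles) {F : FunctionEnsemble}
    {κ ℓ : ℕ → ℕ} (hF : IsPRP F κ ℓ) (hℓ : ∀ n, n ≤ ℓ n) {M : OracleAlg Bool}
    (hM : M.IsPolyTime encodingBoolBool) (q p : Polynomial ℕ) (W : Tables ℓ) (S : Finset ℕ)
    (hS : ∀ m, m ∉ S → W m = id) {δ : ℝ} (hδ : 0 < δ) :
    ∃ n₀ : ℕ, ∀ n, n₀ ≤ n →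
      |rawAvg F κ ℓ n (fun g => accAt M q p (acLang (Function.update W n g)) n) -
          modAvg F κ ℓ n (fun g => accAt M q p (acLang (Function.update W n g)) n)| ≤ δ := by
  obtain ⟨𝒜, h𝒜, hacc⟩ := hc ℓ M hM q p W S hS
  obtain ⟨n₀, hn₀⟩ := aaronsonChen2017_lem75_eventually_le h₁ h₂ hF hℓ h𝒜 hδ
  refine ⟨n₀, fun n hn => ?_⟩
  have hr : rawAvg F κ ℓ n (fun g => accAt M q p (acLang (Function.update W n g)) n) =
      prfRealProb F κ ℓ 𝒜 n := by
    rw [← rawAvg_acceptProb hF.isEfficientFamily 𝒜 n]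
    simp only [hacc]
  have hm : modAvg F κ ℓ n (fun g => accAt M q p (acLang (Function.update W n g)) n) =
      prfModRealProb F κ ℓ 𝒜 n := by
    rw [← modAvg_acceptProb hF.isEfficientFamily 𝒜 n]
    simp only [hacc]
  rw [hr, hm]
  exact hn₀ n hn

/-! ### The stage lemma: at a large level some `PRP^raw` or `PRF^mod` table defeats a given `BPP^O` description -/

/-- **The stage lemma of the diagonalization** (the step "`Pr_O[E_n(M)] = 1/2 + o(1)`, even
conditioning on `E_1(M), …, E_{n−1}(M)`" of the printed proof, derandomized). For every `BPP^O`
description `(M, q, p)` and every finitely supported background, at every large level `n` there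
is a `PRP^raw` table `g` (verdict `β = true`; a permutation) on which `(M, q, p)` accepts `1ⁿ`
with probability `< 2/3`, or a `PRF^mod` table `g` (`β = false`; well-formed key, modulus in `A`)
on which it accepts with probability `> 1/3`. Otherwise the acceptance probability `f` of
`(M, q, p)` satisfies `f ≥ 2/3` on every `PRP^raw` table and `f ≤ 1/3` on every `PRF^mod` table,
so the two key-averages of `f` differ by at least `1/3 > 1/10`, contradicting
`acTables_gap_small`. (The quantum machine plays no role at this step: it rejects EVERY `PRF^mod`
table and accepts EVERY permutation, `aaronsonChen2017_lem75_quantum`.)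
[cite: AaronsonChen2017, Thm. 7.6 (proof, p. 30)] -/
theorem exists_defeating_table (h₁ : aaronsonChen2017_lem75_prp_isPRF)
    (h₂ : aaronsonChen2017_lem75_prfMod_isPRF) (hc : acLang_bppCompiles) {F : FunctionEnsemble}
    {κ ℓ : ℕ → ℕ} (hF : IsPRP F κ ℓ) (hℓ : ∀ n, n ≤ ℓ n)
    {M : OracleAlg Bool} (hM : M.IsPolyTime encodingBoolBool) (q p : Polynomial ℕ) (W : Tables ℓ)
    (S : Finset ℕ) (hS : ∀ m, m ∉ S → W m = id) :
    ∃ n₁ : ℕ, ∀ n, n₁ ≤ n → ∃ (g : Tbl ℓ n) (β : Bool), IsACTable F κ ℓ n g ∧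
      (β = true → Function.Bijective g ∧ accAt M q p (acLang (Function.update W n g)) n < 2 / 3) ∧
      (β = false → (∃ (k : List Bool) (a : ℕ), k.length = κ n ∧ a ∈ zhandryModuli (2 ^ ℓ n) ∧
          g = modTbl F ℓ n k a) ∧ 1 / 3 < accAt M q p (acLang (Function.update W n g)) n) := by
  obtain ⟨n₂, hgap⟩ :=
    acTables_gap_small h₁ h₂ hc hF hℓ hM q p W S hS (δ := 1 / 10) (by norm_num)
  refine ⟨n₂, fun n hn => ?_⟩
  by_contra H
  -- the acceptance probability as a function of the level-`n` table
  set f : Tbl ℓ n → ℝ := fun g => accAt M q p (acLang (Function.update W n g)) n with hf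
  -- on `PRP^raw` tables (permutations) it is at least `2/3`
  have hraw : ∀ k : List.Vector Bool (κ n), 2 / 3 ≤ f (rawTbl F ℓ n k.toList) := by
    intro k
    by_contra hlt
    push Not at hlt
    exact H ⟨rawTbl F ℓ n k.toList, true, Or.inr (Or.inl ⟨k.toList, k.toList_length, rfl⟩),
      fun _ => ⟨rawTbl_bijective hF n k.toList_length, hlt⟩, fun h => Bool.noConfusion h⟩
  -- on `PRF^mod` tables it is at most `1/3`
  have hmodpt : ∀ (k : List.Vector Bool (κ n)) (a : ℕ), a ∈ zhandryModuli (2 ^ ℓ n) →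
      f (modTbl F ℓ n k.toList a) ≤ 1 / 3 := by
    intro k a ha
    by_contra hlt
    push Not at hlt
    exact H ⟨modTbl F ℓ n k.toList a, false,
      Or.inr (Or.inr ⟨k.toList, a, k.toList_length, ha, rfl⟩), fun h => Bool.noConfusion h,
      fun _ => ⟨⟨k.toList, a, k.toList_length, ha, rfl⟩, hlt⟩⟩
  have hR : 2 / 3 ≤ rawAvg F κ ℓ n f := le_rawAvg hraw
  have hMod : modAvg F κ ℓ n f ≤ 1 / 3 := modAvg_le_of_forall_le (by norm_num) hmodpt
  have hg : rawAvg F κ ℓ n f - modAvg F κ ℓ n f ≤ 1 / 10 := (abs_le.1 (hgap n hn)).2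
  linarith

/-! ### The diagonalization (Ko-style stages, as in `OracleSeparationBQPPH.lean`) -/

/-- A state of the stage construction: the current assignment of tables and the first free level
(all lower levels are frozen). [cite: Ko1989, §3] -/
structure DState (ℓ : ℕ → ℕ) where
  /-- The current assignment of a table to every level. -/
  W : Tables ℓ
  /-- Levels below `lvl` are frozen. -/
  lvl : ℕ

section Diag

variable (N₀ : ℕ) (thr : PHDescr → Tables ℓ → ℕ)
  (pick : (D : PHDescr) → Tables ℓ → (n : ℕ) → Tbl ℓ n × Bool) (e : ℕ → PHDescr)

/-- **The stages.** Starting from the identity at every level and the first level `N₀`, stage `i`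
treats the `i`-th description `e i` at the level `n_i = max lvl (thr (e i) W)` (free, and large
enough for the stage lemma *relative to the current background* `W`), writes the defeating table
`pick (e i) W n_i` there, and freezes every level the description may have read at `1^{n_i}`.
[cite: Ko1989, §3] [cite: AaronsonChen2017, Thm. 7.6 (proof, p. 30)] -/
def dSeq : ℕ → DState ℓ
  | 0 => ⟨fun _ => id, N₀⟩
  | i + 1 =>
    ⟨Function.update (dSeq i).W (max (dSeq i).lvl (thr (e i) (dSeq i).W))
        (pick (e i) (dSeq i).W (max (dSeq i).lvl (thr (e i) (dSeq i).W))).1,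
      max (max (dSeq i).lvl (thr (e i) (dSeq i).W) + 1)
        ((e i).reach (max (dSeq i).lvl (thr (e i) (dSeq i).W)) + 1)⟩

/-- The level `n_i` treated at stage `i`. [cite: Ko1989, §3] -/
def dLvl (i : ℕ) : ℕ :=
  max (dSeq N₀ thr pick e i).lvl (thr (e i) (dSeq N₀ thr pick e i).W)

/-- The table and verdict chosen at stage `i`. [cite: Ko1989, §3] -/
def dPick (i : ℕ) : Tbl ℓ (dLvl N₀ thr pick e i) × Bool :=
  pick (e i) (dSeq N₀ thr pick e i).W (dLvl N₀ thr pick e i)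

/-- **The limit assignment**: level `n` is frozen from stage `n + 1` on. [cite: Ko1989, §3] -/
def dW (n : ℕ) : Tbl ℓ n :=
  (dSeq N₀ thr pick e (n + 1)).W n

/-- The assignment after stage `i`. [cite: Ko1989, §3] -/
theorem dSeq_succ_W (i : ℕ) :
    (dSeq N₀ thr pick e (i + 1)).W =
      Function.update (dSeq N₀ thr pick e i).W (dLvl N₀ thr pick e i) (dPick N₀ thr pick e i).1 :=
  rfl

/-- The frozen prefix after stage `i`. [cite: Ko1989, §3] -/
theorem dSeq_succ_lvl (i : ℕ) :
    (dSeq N₀ thr pick e (i + 1)).lvl =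
      max (dLvl N₀ thr pick e i + 1) ((e i).reach (dLvl N₀ thr pick e i) + 1) :=
  rfl

/-- Stage `i` works at a free level. [cite: Ko1989, §3] -/
theorem lvl_le_dLvl (i : ℕ) : (dSeq N₀ thr pick e i).lvl ≤ dLvl N₀ thr pick e i :=
  le_max_left _ _

/-- Stage `i` works at a level large enough for the stage lemma. [cite: Ko1989, §3] -/
theorem thr_le_dLvl (i : ℕ) : thr (e i) (dSeq N₀ thr pick e i).W ≤ dLvl N₀ thr pick e i :=
  le_max_right _ _

/-- The level of stage `i` is frozen afterwards. [cite: Ko1989, §3] -/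
theorem dLvl_lt_lvl_succ (i : ℕ) : dLvl N₀ thr pick e i < (dSeq N₀ thr pick e (i + 1)).lvl := by
  rw [dSeq_succ_lvl]; omega

/-- Everything the `i`-th description read at its probe is frozen afterwards. [cite: Ko1989, §3] -/
theorem reach_lt_lvl_succ (i : ℕ) :
    (e i).reach (dLvl N₀ thr pick e i) < (dSeq N₀ thr pick e (i + 1)).lvl := by
  rw [dSeq_succ_lvl]; omega

/-- The frozen prefix grows by at least one level per stage. [folklore] -/
theorem add_le_dlvl (i : ℕ) : N₀ + i ≤ (dSeq N₀ thr pick e i).lvl := by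
  induction i with
  | zero => exact le_rfl
  | succ i ih =>
    have h1 := lvl_le_dLvl N₀ thr pick e i
    have h2 := dLvl_lt_lvl_succ N₀ thr pick e i
    omega

/-- The frozen prefix only grows. [cite: Ko1989, §3] -/
theorem dlvl_mono {i j : ℕ} (hij : i ≤ j) :
    (dSeq N₀ thr pick e i).lvl ≤ (dSeq N₀ thr pick e j).lvl := by
  induction hij with
  | refl => exact le_rfl
  | step _ ih =>
    exact ih.trans ((lvl_le_dLvl N₀ thr pick e _).trans (dLvl_lt_lvl_succ N₀ thr pick e _).le)

/-- **Freezing**: a level below `lvl_i` keeps its table at all later stages. [cite: Ko1989, §3] -/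
theorem dW_eq_of_lt_lvl' {n i j : ℕ} (hn : n < (dSeq N₀ thr pick e i).lvl) (hij : i ≤ j) :
    (dSeq N₀ thr pick e j).W n = (dSeq N₀ thr pick e i).W n := by
  induction hij with
  | refl => rfl
  | @step j hij ih =>
    rw [dSeq_succ_W, Function.update_of_ne, ih]
    have h1 := dlvl_mono N₀ thr pick e hij
    have h2 := lvl_le_dLvl N₀ thr pick e j
    omega

/-- The limit table of a level frozen at stage `j` is its stage-`j` table. [cite: Ko1989, §3] -/
theorem dW_eq_of_lt_lvl {n j : ℕ} (hn : n < (dSeq N₀ thr pick e j).lvl) :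
    dW N₀ thr pick e n = (dSeq N₀ thr pick e j).W n := by
  unfold dW
  rcases le_total j (n + 1) with h | h
  · exact dW_eq_of_lt_lvl' N₀ thr pick e hn h
  · have hn' : n < (dSeq N₀ thr pick e (n + 1)).lvl :=
      lt_of_lt_of_le (by omega) (add_le_dlvl N₀ thr pick e (n + 1))
    exact (dW_eq_of_lt_lvl' N₀ thr pick e hn' h).symm

/-- The limit table at a stage level is the table picked at that stage. [cite: Ko1989, §3] -/
theorem dW_dLvl (i : ℕ) : dW N₀ thr pick e (dLvl N₀ thr pick e i) = (dPick N₀ thr pick e i).1 := by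
  rw [dW_eq_of_lt_lvl N₀ thr pick e (dLvl_lt_lvl_succ N₀ thr pick e i), dSeq_succ_W,
    Function.update_self]

/-- Every level carries either the identity or the table of the stage that treated it. [folklore] -/
theorem dW_eq_or (n : ℕ) : dW N₀ thr pick e n = id ∨ ∃ i, dLvl N₀ thr pick e i = n := by
  suffices h : ∀ j, (dSeq N₀ thr pick e j).W n = id ∨ ∃ i, dLvl N₀ thr pick e i = n from h (n + 1)
  intro j
  induction j with
  | zero => exact Or.inl rfl
  | succ j ih =>
    by_cases hj : dLvl N₀ thr pick e j = n
    · exact Or.inr ⟨j, hj⟩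
    · rw [dSeq_succ_W, Function.update_of_ne (Ne.symm hj)]
      exact ih

/-- **Finite support**: after stage `i` only the levels `n_0, …, n_{i−1}` differ from the identity
(so the background of every stage is finitely supported, as the compilation leaf requires). [folklore] -/
theorem dSeq_W_eq_id (i : ℕ) :
    ∀ m, m ∉ (Finset.range i).image (dLvl N₀ thr pick e) → (dSeq N₀ thr pick e i).W m = id := by
  induction i with
  | zero => intro m _; rfl
  | succ i ih =>
    intro m hm
    have hm' : m ∉ (Finset.range i).image (dLvl N₀ thr pick e) := fun h => hm (by
      rw [Finset.mem_image] at h ⊢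
      obtain ⟨j, hj, hjm⟩ := h
      exact ⟨j, Finset.mem_range.2 (Nat.lt_succ_of_lt (Finset.mem_range.1 hj)), hjm⟩)
    have hne : m ≠ dLvl N₀ thr pick e i := fun h =>
      hm (Finset.mem_image.2 ⟨i, Finset.mem_range.2 (Nat.lt_succ_self i), h.symm⟩)
    rw [dSeq_succ_W, Function.update_of_ne hne]
    exact ih m hm'

/-- After stage `i`, the oracle no longer changes below the reach of the `i`-th description at its
probe, so its acceptance probability there is final. [cite: Ko1989, §3] -/
theorem mem_acLang_dW_iff (i : ℕ) (s : List Bool)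
    (hs : s.length ≤ (e i).reach (dLvl N₀ thr pick e i)) :
    s ∈ acLang (dW N₀ thr pick e) ↔ s ∈ acLang (dSeq N₀ thr pick e (i + 1)).W := by
  refine acLang_congr (fun m hm => ?_) s hs
  exact dW_eq_of_lt_lvl N₀ thr pick e (lt_of_le_of_lt hm (reach_lt_lvl_succ N₀ thr pick e i))

end Diag

/-! ### Assembly: Thm. 7.6 from a secure PRP, from the leaves -/

/-- **Aaronson–Chen 2017, §7.2–7.3 (`PRPExist → PPolyOracleSeparation`) from the five leaves**
(and countability of polynomial-time oracle machines). Given the secure PRP `F`, take the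
threshold `n₀` and the uniform family `U` of the quantum leaf; enumerate the `BPP^O` descriptions
(`exists_enum_PHDescr`); run the stages `dSeq` with the thresholds and choices of
`exists_defeating_table` (relative to the current, finitely supported background); let
`O = acLang W` be the limit. Then `O ∈ P/poly` (every level is an identity, `PRP^raw` or
`PRF^mod` table; leaf), `L = {x : |x| < n₀ ∨ W |x| is a permutation} ∈ BQP^O` (the family
accepts below `n₀`, accepts permutation levels and rejects `PRF^mod` levels, and every level is
one or the other), and `L ∉ BPP^O`: a `bp (P^O)` witness `(M, q, p)` is the `i`-th description
for some `i`, and at the level `n_i ≥ n₀` of stage `i` its acceptance probability at `1^{n_i}` —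
unchanged since stage `i + 1` by locality — is on the wrong side of the `2/3`-promise (a
permutation accepted with probability `< 2/3`, or a `PRF^mod` table, not a permutation by
`modTbl_not_injective`, accepted with probability `> 1/3`). Hence `BPP^O ≠ BQP^O`.
[cite: AaronsonChen2017, Thm. 7.6 (proof, p. 30)] [cite: Ko1989, §3] -/
theorem aaronsonChen2017_thm76_of_prp_of_parts (h₁ : aaronsonChen2017_lem75_prp_isPRF)
    (h₂ : aaronsonChen2017_lem75_prfMod_isPRF) (hq : aaronsonChen2017_lem75_quantum)
    (hc : acLang_bppCompiles) (hp : aaronsonChen2017_thm76_ppoly)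
    (h5 : countable_polyTimeOracleAlg) : aaronsonChen2017_thm76_of_prp := by
  classical
  rintro ⟨F, κ, ℓ, hF, hℓ⟩
  obtain ⟨n₀, U, hU, hlow, hperm, hmod⟩ := hq F κ ℓ hF hℓ
  -- enumeration of the descriptions
  obtain ⟨e, he⟩ := exists_enum_PHDescr h5
  -- thresholds of the stage lemma, relative to the background
  have hstage : ∀ (D : PHDescr) (W : Tables ℓ), ∃ n₁ : ℕ,
      (D.M.IsPolyTime encodingBoolBool ∧ ∃ S : Finset ℕ, ∀ m, m ∉ S → W m = id) →
        ∀ n, n₁ ≤ n → ∃ (g : Tbl ℓ n) (β : Bool), IsACTable F κ ℓ n g ∧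
          (β = true → Function.Bijective g ∧
            accAt D.M D.q (D.bounds.headD 0) (acLang (Function.update W n g)) n < 2 / 3) ∧
          (β = false → (∃ (k : List Bool) (a : ℕ), k.length = κ n ∧
              a ∈ zhandryModuli (2 ^ ℓ n) ∧ g = modTbl F ℓ n k a) ∧
            1 / 3 < accAt D.M D.q (D.bounds.headD 0) (acLang (Function.update W n g)) n) := by
    intro D W
    by_cases hD : D.M.IsPolyTime encodingBoolBool ∧ ∃ S : Finset ℕ, ∀ m, m ∉ S → W m = id
    · obtain ⟨hM, S, hS⟩ := hD
      obtain ⟨n₁, h⟩ := exists_defeating_table h₁ h₂ hc hF hℓ hM D.q (D.bounds.headD 0) W S hS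
      exact ⟨n₁, fun _ => h⟩
    · exact ⟨0, fun h => absurd h hD⟩
  choose thr hthr using hstage
  -- choices of the stage lemma (identity, a permutation, where the lemma does not apply)
  have hpick' : ∀ (D : PHDescr) (W : Tables ℓ) (n : ℕ), ∃ pr : Tbl ℓ n × Bool,
      IsACTable F κ ℓ n pr.1 ∧
      ((pr.2 = true → Function.Bijective pr.1) ∧
        (pr.2 = false → ∃ (k : List Bool) (a : ℕ), k.length = κ n ∧
          a ∈ zhandryModuli (2 ^ ℓ n) ∧ pr.1 = modTbl F ℓ n k a)) ∧
      ((D.M.IsPolyTime encodingBoolBool ∧ ∃ S : Finset ℕ, ∀ m, m ∉ S → W m = id) → thr D W ≤ n →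
        (pr.2 = true → Function.Bijective pr.1 ∧
          accAt D.M D.q (D.bounds.headD 0) (acLang (Function.update W n pr.1)) n < 2 / 3) ∧
        (pr.2 = false → (∃ (k : List Bool) (a : ℕ), k.length = κ n ∧
            a ∈ zhandryModuli (2 ^ ℓ n) ∧ pr.1 = modTbl F ℓ n k a) ∧
          1 / 3 < accAt D.M D.q (D.bounds.headD 0) (acLang (Function.update W n pr.1)) n)) := by
    intro D W n
    by_cases h : (D.M.IsPolyTime encodingBoolBool ∧ ∃ S : Finset ℕ, ∀ m, m ∉ S → W m = id) ∧
        thr D W ≤ n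
    · obtain ⟨g, β, hT, ht, hf⟩ := hthr D W h.1 n h.2
      exact ⟨(g, β), hT, ⟨fun hβ => (ht hβ).1, fun hβ => (hf hβ).1⟩, fun _ _ => ⟨ht, hf⟩⟩
    · exact ⟨(id, true), Or.inl rfl, ⟨fun _ => id_bijective_tbl n, fun hβ => Bool.noConfusion hβ⟩,
        fun h1 h2 => absurd ⟨h1, h2⟩ h⟩
  choose pick hpick using hpick'
  -- the oracle
  set W : Tables ℓ := dW n₀ thr pick e with hW
  have hfin : ∀ i, ∃ S : Finset ℕ, ∀ m, m ∉ S → (dSeq n₀ thr pick e i).W m = id :=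
    fun i => ⟨_, dSeq_W_eq_id n₀ thr pick e i⟩
  have hn₀lvl : ∀ i, n₀ ≤ dLvl n₀ thr pick e i := fun i =>
    le_trans (le_trans (Nat.le_add_right n₀ i) (add_le_dlvl n₀ thr pick e i))
      (lvl_le_dLvl n₀ thr pick e i)
  -- every level is an identity / `PRP^raw` / `PRF^mod` table
  have hACT : ∀ n, IsACTable F κ ℓ n (W n) := by
    intro n
    rcases dW_eq_or n₀ thr pick e n with h | ⟨i, rfl⟩
    · rw [hW, h]; exact Or.inl rfl
    · rw [hW, dW_dLvl]; exact (hpick _ _ _).1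
  refine ⟨acLang W, hp F κ ℓ hF hℓ W hACT, fun hEq => ?_⟩
  -- the separating language and its `BQP^O` machine
  set L : Language Bool := {x | x.length < n₀ ∨ Function.Bijective (W x.length)} with hL
  have hLBQP : L ∈ BQPRel (acLang W) := by
    refine ⟨U, hU, fun x => ⟨fun hx => ?_, fun hx => ?_⟩⟩
    · rcases lt_or_ge x.length n₀ with hlt | hge
      · exact hlow _ x hlt
      · rcases hx with h | h
        · exact absurd h (not_lt.2 hge)
        · exact hperm W x hge h
    · rcases lt_or_ge x.length n₀ with hlt | hge
      · exact absurd (Or.inl hlt) hx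
      · have hnb : ¬ Function.Bijective (W x.length) := fun h => hx (Or.inr h)
        rcases hACT x.length with h | ⟨k, hk, h⟩ | ⟨k, a, hk, ha, h⟩
        · exact absurd (by rw [h]; exact id_bijective_tbl x.length) hnb
        · exact absurd (by rw [h]; exact rawTbl_bijective hF x.length hk) hnb
        · exact hmod W x hge k a hk ha h
  have hLBPP : L ∈ BPPRel (Oracle.ofLanguage (acLang W)) := by
    rw [hEq]; exact hLBQP
  -- a `bp (P^O)` witness: a `P^O` machine `M` with bound `q` on pairs, and coins `p`
  obtain ⟨L', ⟨M, hM, q, hq'⟩, p, hp'⟩ := hLBPP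
  have hbase : baseLang M q (acLang W) = L' := baseLang_eq_of_PRel hq'
  -- its description `⟨[p], M, q⟩` is some `e i`; stage `i` defeated it
  obtain ⟨i, hi⟩ := he (show (⟨[p], M, q⟩ : PHDescr) ∈
    {D : PHDescr | D.M.IsPolyTime encodingBoolBool} from hM)
  have hMi : (e i).M.IsPolyTime encodingBoolBool := by rw [hi]; exact hM
  obtain ⟨-, -, hg⟩ := hpick (e i) (dSeq n₀ thr pick e i).W (dLvl n₀ thr pick e i)
  obtain ⟨ht, hf⟩ := hg ⟨hMi, hfin i⟩ (thr_le_dLvl n₀ thr pick e i)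
  have heM : (e i).M = M := by rw [hi]
  have heq : (e i).q = q := by rw [hi]
  have hep : (e i).bounds.headD 0 = p := by rw [hi]; rfl
  simp only [heM, heq, hep] at ht hf
  set n := dLvl n₀ thr pick e i with hn
  have hdp : dPick n₀ thr pick e i = pick (e i) (dSeq n₀ thr pick e i).W n := rfl
  have hWn : W n = (pick (e i) (dSeq n₀ thr pick e i).W n).1 := by
    rw [hW, ← hdp]; exact dW_dLvl n₀ thr pick e i
  have hN₀n : n₀ ≤ n := hn₀lvl i
  -- locality: the acceptance probability at `1ⁿ` is the same for the stage-`i+1` oracle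
  have hpatch : acLang (Function.update (dSeq n₀ thr pick e i).W n
      (pick (e i) (dSeq n₀ thr pick e i).W n).1) = acLang (dSeq n₀ thr pick e (i + 1)).W := rfl
  have hloc : accAt M q p (acLang W) n = accAt M q p (acLang (dSeq n₀ thr pick e (i + 1)).W) n :=
    accAt_congr M q p n fun s hs => by
      rw [hW]
      refine mem_acLang_dW_iff n₀ thr pick e i s ?_
      rw [hi]; exact hs
  -- membership of `1ⁿ` in `L` versus the promise of the `BPP^O` machine
  have hmemL : List.replicate n true ∈ L ↔ Function.Bijective (W n) := by
    have hlen : (List.replicate n true).length = n := by simp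
    change ((List.replicate n true).length < n₀ ∨
      Function.Bijective (W (List.replicate n true).length)) ↔ _
    rw [hlen]
    exact ⟨fun h => h.resolve_left (not_lt.2 hN₀n), Or.inr⟩
  have hprob := hp' (List.replicate n true)
  rw [List.length_replicate] at hprob
  cases hβ : (pick (e i) (dSeq n₀ thr pick e i).W n).2
  · -- verdict `false`: level `n` holds a `PRF^mod` table, `1ⁿ ∉ L`, yet `M` accepts with probability `> 1/3`
    obtain ⟨⟨k, a, hk, ha, hga⟩, hacc⟩ := hf hβ
    have hnot : List.replicate n true ∉ L := fun h => by
      have h' := hmemL.1 h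
      rw [hWn, hga] at h'
      exact modTbl_not_injective hF.isEfficientFamily n hk ha h'.1
    have hset : {y : List Bool | boolPair (List.replicate n true) y ∈ L' ↔ List.replicate n true ∈ L} =
        {y : List Bool | boolPair (List.replicate n true) y ∈ baseLang M q (acLang W)}ᶜ := by
      ext y
      simp only [Set.mem_setOf_eq, Set.mem_compl_iff, hbase, iff_false_right hnot]
    rw [hset, uniformProb_compl] at hprob
    change 2 / 3 ≤ 1 - accAt M q p (acLang W) n at hprob
    rw [hloc, ← hpatch] at hprob
    linarith
  · -- verdict `true`: level `n` holds a permutation, `1ⁿ ∈ L`, yet `M` accepts with probability `< 2/3`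
    obtain ⟨hq1, hacc⟩ := ht hβ
    have hmem : List.replicate n true ∈ L := hmemL.2 (by rw [hWn]; exact hq1)
    have hset : {y : List Bool | boolPair (List.replicate n true) y ∈ L' ↔ List.replicate n true ∈ L} =
        {y : List Bool | boolPair (List.replicate n true) y ∈ baseLang M q (acLang W)} := by
      ext y
      simp only [Set.mem_setOf_eq, hbase, iff_true_right hmem]
    rw [hset] at hprob
    change 2 / 3 ≤ accAt M q p (acLang W) n at hprob
    rw [hloc, ← hpatch] at hprob
    linarith

/-- The same with countability of polynomial-time oracle machines discharged
(`countable_polyTimeOracleAlg_holds`): **`aaronsonChen2017_thm76_of_prp` from its five leaves.**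
[cite: AaronsonChen2017, Thm. 7.6 (proof, p. 30)] -/
theorem aaronsonChen2017_thm76_of_prp_of_leaves (h₁ : aaronsonChen2017_lem75_prp_isPRF)
    (h₂ : aaronsonChen2017_lem75_prfMod_isPRF) (hq : aaronsonChen2017_lem75_quantum)
    (hc : acLang_bppCompiles) (hp : aaronsonChen2017_thm76_ppoly) : aaronsonChen2017_thm76_of_prp :=
  aaronsonChen2017_thm76_of_prp_of_parts h₁ h₂ hq hc hp countable_polyTimeOracleAlg_holds

/-- **Thm. 7.6 from all its leaves**: HILL (`PRGExist_iff_OWFExist`), GGM (`PRFExist_of_PRGExist`),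
Luby–Rackoff (`PRPExist_of_PRFExist`) — Lemma 7.4 — and the five leaves of §7.2–7.3 above.
[cite: AaronsonChen2017, Thm. 7.6, Lemma 7.4, Lemma 7.5] -/
theorem aaronsonChen2017_thm76_of_leaves' (hHILL : PRGExist_iff_OWFExist)
    (hGGM : PRFExist_of_PRGExist) (hLR : PRPExist_of_PRFExist)
    (h₁ : aaronsonChen2017_lem75_prp_isPRF) (h₂ : aaronsonChen2017_lem75_prfMod_isPRF)
    (hq : aaronsonChen2017_lem75_quantum) (hc : acLang_bppCompiles)
    (hp : aaronsonChen2017_thm76_ppoly) : aaronsonChen2017_thm76 :=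
  aaronsonChen2017_thm76_of_parts' hHILL hGGM hLR
    (aaronsonChen2017_thm76_of_prp_of_leaves h₁ h₂ hq hc hp)

end Literature.Barriers.QuantumAdvantage

end
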